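import Summits.AtomisticToContinuum.BoseEinsteinCondensation.Theorems.GaussianDominationCan.Negative.CruxForms
import Summits.AtomisticToContinuum.BoseEinsteinCondensation.Theorems.GaussianDominationCan.Negative.ProductStates
import Literature.MathematicalPhysics.QuantumManyBody.PeriodicBoseGasFracEnergy

/-!
# Crux `FibreConductance` (stmt-AtomisticToContinuum-9480) — negative-side toolkit: the real
two-mode product state `g^{⊗N}`, `g = a + b(e_n + e_{-n})`

Refuter (drefute) support file for the line `parseval-shell-bootstrap` of the crux
`BECThomsonPrinciple.FibreConductance`.  The witness state of `ShellOccupationNearMinimiser.lean`: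
the REAL, POSITIVE, Bose-symmetric product state `Φ = g^{⊗N}` on the torus with
`g = a + b(e_n + e_{-n}) = a + 2b cos(2π n·x/L)`, `a > 2b ≥ 0`, normalised by `(a² + 2b²)L³ = 1`
(`cosState`).  Exact data: `|Φ| = Φ` (`norm_cosFun_eq`), the occupation of the plane wave `φ_{-n}`
in `Φ` is `N·b²L³` (`cellOccupation_neg_cosFun`), and its free kinetic energy is
`≤ N·4b²L³·4π²|n|²/L²` (`periodicEnergy_cosState_le`).  Built on the product calculus of
`Theorems/GaussianDominationCan/Negative` (`prodFun`, `oneBody`, `lintegral_prod_erase`).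
All [folklore].
-/

noncomputable section

namespace Summit.AtomisticToContinuum.BoseEinsteinCondensation.Theorems.FibreConductance.Negative

open MeasureTheory Literature.MathematicalPhysics.QuantumManyBody.BoseGas
open Summit.AtomisticToContinuum.BoseEinsteinCondensation.Theorems.GaussianDominationCan.Negative
open scoped ENNReal NNReal ComplexConjugate

variable {L : ℝ} {n : Fin 3 → ℤ} {a b : ℝ}

/-! ### The real two-mode factor `g = a + b(e_n + e_{-n})` -/

/-- `g = a + b (e_n + e_{-n}) = a + 2b cos(2π n·x/L)`. -/
def cosBody (L : ℝ) (n : Fin 3 → ℤ) (a b : ℝ) (x : Space) : ℂ :=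
  (a : ℂ) + (b : ℂ) * (cellWave L n x + cellWave L (-n) x)

/-- The real profile `a + 2b Re e_n`. -/
def cosRe (L : ℝ) (n : Fin 3 → ℤ) (a b : ℝ) (x : Space) : ℝ :=
  a + 2 * b * (cellWave L n x).re

/-- `g` is the real profile. [folklore] -/
theorem cosBody_eq_ofReal (x : Space) : cosBody L n a b x = ((cosRe L n a b x : ℝ) : ℂ) := by
  unfold cosBody cosRe
  rw [← conj_cellWave, Complex.add_conj]
  push_cast
  ring

/-- `|Re e_n| ≤ 1`. [folklore] -/
theorem abs_re_cellWave_le (L : ℝ) (n : Fin 3 → ℤ) (x : Space) : |(cellWave L n x).re| ≤ 1 :=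
  (Complex.abs_re_le_norm _).trans (norm_cellWave L n x).le

/-- The real profile is positive when `a > 2b ≥ 0`. [folklore] -/
theorem cosRe_pos (ha : 2 * b < a) (hb : 0 ≤ b) (x : Space) : 0 < cosRe L n a b x := by
  unfold cosRe
  have h := abs_re_cellWave_le L n x
  have h1 : -1 ≤ (cellWave L n x).re := (abs_le.mp h).1
  nlinarith

/-- `g` is continuous. [folklore] -/
theorem continuous_cosBody (L : ℝ) (n : Fin 3 → ℤ) (a b : ℝ) : Continuous (cosBody L n a b) :=
  continuous_const.add (continuous_const.mul
    ((contDiff_cellWave L n).continuous.add (contDiff_cellWave L (-n)).continuous))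

/-- `g` is `C¹`. [folklore] -/
theorem contDiff_cosBody (L : ℝ) (n : Fin 3 → ℤ) (a b : ℝ) : ContDiff ℝ 1 (cosBody L n a b) :=
  contDiff_const.add (contDiff_const.mul
    (((contDiff_cellWave L n).of_le (mod_cast le_top)).add
      ((contDiff_cellWave L (-n)).of_le (mod_cast le_top))))

/-- `g` is differentiable. [folklore] -/
theorem differentiable_cosBody (L : ℝ) (n : Fin 3 → ℤ) (a b : ℝ) :
    Differentiable ℝ (cosBody L n a b) :=
  (contDiff_cosBody L n a b).differentiable one_ne_zero

/-- `g` is `Lℤ³`-periodic. [folklore] -/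
theorem cosBody_periodic (hL : L ≠ 0) (a b : ℝ) (x : Space) (k : Fin 3) :
    cosBody L n a b (x + EuclideanSpace.single k L) = cosBody L n a b x := by
  simp [cosBody, cellWave_periodic hL]

/-- `g` as the sum of the two-mode function `a + b e_n` and `b e_{-n}`. [folklore] -/
theorem cosBody_eq_oneBody_add (x : Space) :
    cosBody L n a b x = oneBody L n a b x + (b : ℂ) * cellWave L (-n) x := by
  unfold cosBody oneBody
  ring

/-- `n ≠ 0 ⇒ n + n ≠ 0` in `ℤ³`. [folklore] -/
theorem add_self_ne_zero (hn : n ≠ 0) : n + n ≠ 0 := by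
  obtain ⟨j, hj⟩ := Function.ne_iff.1 hn
  change n j ≠ 0 at hj
  intro h
  apply hj
  have h2 := congrFun h j
  change n j + n j = 0 at h2
  omega

/-- `(Re e_n)² = (1 + Re e_{2n})/2`. [folklore] -/
theorem re_cellWave_sq (L : ℝ) (n : Fin 3 → ℤ) (x : Space) :
    (cellWave L n x).re ^ 2 = (1 + (cellWave L (n + n) x).re) / 2 := by
  have h1 := normSq_cellWave L n x
  have h2 : (cellWave L (n + n) x).re = (cellWave L n x).re ^ 2 - (cellWave L n x).im ^ 2 := by
    rw [cellWave_add_index, Complex.mul_re]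
    ring
  rw [h2]
  linarith

/-- `|g|² = a² + 2b² + 4ab Re e_n + 2b² Re e_{2n}`. [folklore] -/
theorem norm_sq_cosBody (x : Space) :
    ‖cosBody L n a b x‖ ^ 2 =
      (a ^ 2 + 2 * b ^ 2) + (4 * a * b * (cellWave L n x).re + 2 * b ^ 2 * (cellWave L (n + n) x).re) := by
  rw [cosBody_eq_ofReal, Complex.norm_real, Real.norm_eq_abs, sq_abs, cosRe]
  have h := re_cellWave_sq L n x
  nlinarith [h]

/-- `∫_cell |g|² = (a² + 2b²) L³` for `n ≠ 0`. [folklore] -/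
theorem integral_norm_sq_cosBody (hL : 0 < L) (hn : n ≠ 0) (a b : ℝ) :
    ∫ x in cell L, ‖cosBody L n a b x‖ ^ 2 = (a ^ 2 + 2 * b ^ 2) * L ^ 3 := by
  simp_rw [norm_sq_cosBody]
  have hc1 : Continuous fun x => 4 * a * b * (cellWave L n x).re := by fun_prop
  have hc2 : Continuous fun x => 2 * b ^ 2 * (cellWave L (n + n) x).re := by fun_prop
  rw [integral_add (integrableOn_cell (f := fun _ => a ^ 2 + 2 * b ^ 2) continuous_const)
      (integrableOn_cell (f := fun x => 4 * a * b * (cellWave L n x).re +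
        2 * b ^ 2 * (cellWave L (n + n) x).re) (hc1.add hc2)),
    integral_add (integrableOn_cell (f := fun x => 4 * a * b * (cellWave L n x).re) hc1)
      (integrableOn_cell (f := fun x => 2 * b ^ 2 * (cellWave L (n + n) x).re) hc2)]
  rw [setIntegral_const, volume_real_cell hL.le, integral_const_mul, integral_const_mul,
    integral_cell_re_cellWave hL hn, integral_cell_re_cellWave hL (add_self_ne_zero hn),
    mul_zero, mul_zero, add_zero, add_zero, smul_eq_mul, mul_comm]

/-- `∫⁻_cell ‖g‖₊² = (a² + 2b²) L³` (`ℝ≥0∞` form). [folklore] -/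
theorem lintegral_nnnorm_sq_cosBody (hL : 0 < L) (hn : n ≠ 0) (a b : ℝ) :
    ∫⁻ x in cell L, (‖cosBody L n a b x‖₊ : ℝ≥0∞) ^ 2 =
      ENNReal.ofReal ((a ^ 2 + 2 * b ^ 2) * L ^ 3) := by
  simp_rw [coe_nnnorm_sq_eq_ofReal]
  rw [← ofReal_integral_eq_lintegral_ofReal (integrableOn_sq_cell L (continuous_cosBody L n a b))
    (Filter.Eventually.of_forall fun x => by positivity), integral_norm_sq_cosBody hL hn]

/-- `‖g‖₊²` is measurable. [folklore] -/
theorem measurable_nnnorm_sq_cosBody (L : ℝ) (n : Fin 3 → ℤ) (a b : ℝ) :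
    Measurable fun x => ((‖cosBody L n a b x‖₊ : ℝ≥0∞) ^ 2) :=
  (continuous_cosBody L n a b).measurable.nnnorm.coe_nnreal_ennreal.pow_const _

/-! #### The gradient of `g` -/

/-- `∂_j g = ∂_j(a + b e_n) + b ∂_j e_{-n}`. [folklore] -/
theorem fderiv_cosBody_single (a b : ℝ) (x : Space) (j : Fin 3) :
    fderiv ℝ (cosBody L n a b) x (EuclideanSpace.single j 1) =
      fderiv ℝ (oneBody L n a b) x (EuclideanSpace.single j 1) +
        (b : ℂ) * ((2 * Real.pi * Complex.I * ((-n) j) / L) * cellWave L (-n) x) := by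
  have hfun : cosBody L n a b = oneBody L n a b + fun y => (b : ℂ) * cellWave L (-n) y := by
    funext y; rw [Pi.add_apply]; exact cosBody_eq_oneBody_add y
  have hd : Differentiable ℝ (cellWave L (-n)) := (contDiff_cellWave L (-n)).differentiable (by simp)
  rw [hfun, (((differentiable_oneBody L n a b) x).hasFDerivAt.add
    (((hd x).hasFDerivAt).const_mul (b : ℂ))).fderiv]
  simp only [_root_.add_apply, FunLike.coe_smul, Pi.smul_apply, fderiv_cellWave_apply_single,
    smul_eq_mul]

/-- `‖∂_j g‖₊² ≤ 4 b² (2π n_j/L)²`. [folklore] -/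
theorem nnnorm_sq_fderiv_cosBody_le (hL : 0 < L) (a b : ℝ) (x : Space) (j : Fin 3) :
    ((‖fderiv ℝ (cosBody L n a b) x (EuclideanSpace.single j 1)‖₊ : ℝ≥0∞) ^ 2) ≤
      ENNReal.ofReal (4 * (b ^ 2 * (4 * Real.pi ^ 2 * (n j : ℝ) ^ 2 / L ^ 2))) := by
  rw [fderiv_cosBody_single, coe_nnnorm_sq_eq_ofReal]
  apply ENNReal.ofReal_le_ofReal
  set u := fderiv ℝ (oneBody L n a b) x (EuclideanSpace.single j 1) with hu
  set w := (b : ℂ) * ((2 * Real.pi * Complex.I * ((-n) j) / L) * cellWave L (-n) x) with hw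
  have hu2 : ‖u‖ ^ 2 = b ^ 2 * (4 * Real.pi ^ 2 * (n j : ℝ) ^ 2 / L ^ 2) := by
    have h := nnnorm_sq_fderiv_oneBody (n := n) hL a b x j
    rw [coe_nnnorm_sq_eq_ofReal] at h
    have := ENNReal.ofReal_eq_ofReal_iff (by positivity) (by positivity) |>.mp h
    rw [hu]; exact this
  have hw2 : ‖w‖ ^ 2 = b ^ 2 * (4 * Real.pi ^ 2 * (n j : ℝ) ^ 2 / L ^ 2) := by
    rw [hw, norm_mul, norm_mul, Complex.norm_real, Real.norm_eq_abs, norm_cellWave, mul_one]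
    have : ‖(2 * Real.pi * Complex.I * ((-n) j) / L : ℂ)‖ = 2 * Real.pi * |((n j : ℤ) : ℝ)| / L := by
      rw [show (2 * Real.pi * Complex.I * ((-n) j) / L : ℂ) =
          ((-(2 * Real.pi * (n j : ℝ) / L) : ℝ) : ℂ) * Complex.I by simp; ring]
      rw [norm_mul, Complex.norm_I, mul_one, Complex.norm_real, Real.norm_eq_abs, abs_neg, abs_div,
        abs_mul, abs_of_pos (by positivity : (0 : ℝ) < 2 * Real.pi), abs_of_pos hL]
    rw [this, mul_pow, sq_abs, div_pow]
    have h4 : (2 * Real.pi * |((n j : ℤ) : ℝ)|) ^ 2 = 4 * Real.pi ^ 2 * ((n j : ℤ) : ℝ) ^ 2 := by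
      rw [mul_pow, mul_pow, sq_abs]; ring
    rw [h4]
  have h1 : ‖u + w‖ ^ 2 ≤ (‖u‖ + ‖w‖) ^ 2 := pow_le_pow_left₀ (norm_nonneg _) (norm_add_le u w) 2
  nlinarith [h1, sq_nonneg (‖u‖ - ‖w‖), hu2, hw2]

/-- `|∇g|² ≤ 4b²·4π²|n|²/L²`. [folklore] -/
theorem sum_nnnorm_sq_fderiv_cosBody_le (hL : 0 < L) (a b : ℝ) (x : Space) :
    ∑ j : Fin 3, ((‖fderiv ℝ (cosBody L n a b) x (EuclideanSpace.single j 1)‖₊ : ℝ≥0∞) ^ 2) ≤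
      ENNReal.ofReal (4 * (b ^ 2 * (4 * Real.pi ^ 2 * nsq n / L ^ 2))) := by
  calc ∑ j : Fin 3, ((‖fderiv ℝ (cosBody L n a b) x (EuclideanSpace.single j 1)‖₊ : ℝ≥0∞) ^ 2)
      ≤ ∑ j : Fin 3, ENNReal.ofReal (4 * (b ^ 2 * (4 * Real.pi ^ 2 * (n j : ℝ) ^ 2 / L ^ 2))) :=
        Finset.sum_le_sum fun j _ => nnnorm_sq_fderiv_cosBody_le hL a b x j
    _ = ENNReal.ofReal (4 * (b ^ 2 * (4 * Real.pi ^ 2 * nsq n / L ^ 2))) := by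
        rw [← ENNReal.ofReal_sum_of_nonneg (fun j _ => by positivity)]
        congr 1
        unfold nsq
        rw [Finset.mul_sum, Finset.sum_div, Finset.mul_sum, Finset.mul_sum]

/-! ### The product state `Φ = g^{⊗N}` -/

section CosState

variable {m : ℕ}

/-- `g^{⊗N}`. -/
def cosFun (m : ℕ) (L : ℝ) (n : Fin 3 → ℤ) (a b : ℝ) : Config (m + 1) → ℂ :=
  prodFun (fun _ : Fin (m + 1) => cosBody L n a b)

/-- `g^{⊗N}` as an admissible periodic Bose trial state (normalisation `(a² + 2b²) L³ = 1`). -/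
def cosState (m : ℕ) (hL : 0 < L) (hn : n ≠ 0) (a b : ℝ) (hab : (a ^ 2 + 2 * b ^ 2) * L ^ 3 = 1) :
    PeriodicTrialState (m + 1) L where
  ψ := cosFun m L n a b
  contDiff := contDiff_prodFun fun _ => contDiff_cosBody L n a b
  periodic X i k := prodFun_periodic (fun _ x k => cosBody_periodic hL.ne' a b x k) X i k
  symm σ X := prodFun_const_symm _ σ X
  norm_eq := by
    show ∫⁻ X in cellN (m + 1) L,
      (‖prodFun (fun _ : Fin (m + 1) => cosBody L n a b) X‖₊ : ℝ≥0∞) ^ 2 = 1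
    rw [lintegral_nnnorm_sq_prodFun (fun _ => continuous_cosBody L n a b)]
    simp only [lintegral_nnnorm_sq_cosBody hL hn, hab, ENNReal.ofReal_one, Finset.prod_const_one]

/-- `g^{⊗N}` is real and positive: its modulus, recast to `ℂ`, is itself (`a > 2b ≥ 0`). [folklore] -/
theorem norm_cosFun_eq (ha : 2 * b < a) (hb : 0 ≤ b) (X : Config (m + 1)) :
    ((‖cosFun m L n a b X‖ : ℝ) : ℂ) = cosFun m L n a b X := by
  unfold cosFun prodFun
  simp_rw [cosBody_eq_ofReal]
  rw [← Complex.ofReal_prod, Complex.norm_real, Real.norm_of_nonneg]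
  exact Finset.prod_nonneg fun i _ => (cosRe_pos ha hb (X i)).le

/-- `g^{⊗N}` has no zeros (`a > 2b ≥ 0`). [folklore] -/
theorem cosFun_ne_zero (ha : 2 * b < a) (hb : 0 ≤ b) (X : Config (m + 1)) :
    cosFun m L n a b X ≠ 0 := by
  unfold cosFun prodFun
  simp_rw [cosBody_eq_ofReal]
  rw [← Complex.ofReal_prod, Complex.ofReal_ne_zero]
  exact (Finset.prod_pos fun i _ => cosRe_pos ha hb (X i)).ne'

/-! #### The occupation of `φ_{-n}` -/

/-- `∫_cell conj(φ_{-n}) g = L^{-3/2} · L³ b` (`e_n·a`, `e_n·b e_n` integrate to zero, `e_n·b e_{-n} = b`).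
[folklore] -/
theorem integral_conj_planeWaveMode_neg_mul_cosBody (hL : 0 < L) (hn : n ≠ 0) (a b : ℝ) :
    ∫ x in cell L, conj (planeWaveMode L (-n) x) * cosBody L n a b x =
      ((Real.sqrt (L ^ 3))⁻¹ : ℂ) * ((L : ℂ) ^ 3 * b) := by
  have hpt : ∀ x, conj (planeWaveMode L (-n) x) * cosBody L n a b x =
      ((Real.sqrt (L ^ 3))⁻¹ : ℂ) * ((a : ℂ) * cellWave L n x + (b : ℂ) * cellWave L (n + n) x + (b : ℂ)) := by
    intro x
    rw [planeWaveMode_eq, map_mul, conj_cellWave, neg_neg]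
    have hs : conj ((Real.sqrt (L ^ 3))⁻¹ : ℂ) = ((Real.sqrt (L ^ 3))⁻¹ : ℂ) := by
      rw [← Complex.ofReal_inv, Complex.conj_ofReal]
    rw [hs, cosBody, cellWave_add_index]
    have h0 : cellWave L n x * cellWave L (-n) x = 1 := by
      rw [← cellWave_add_index, add_neg_cancel, cellWave_zero]
    linear_combination ((Real.sqrt (L ^ 3))⁻¹ : ℂ) * (b : ℂ) * h0
  simp_rw [hpt]
  rw [integral_const_mul]
  congr 1
  have h1 : Continuous fun x => (a : ℂ) * cellWave L n x := by fun_prop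
  have h2 : Continuous fun x => (b : ℂ) * cellWave L (n + n) x := by fun_prop
  rw [integral_add (integrableOn_cell (f := fun x => (a : ℂ) * cellWave L n x +
        (b : ℂ) * cellWave L (n + n) x) (h1.add h2)) (integrableOn_cell (f := fun _ => (b : ℂ)) continuous_const),
    integral_add (integrableOn_cell (f := fun x => (a : ℂ) * cellWave L n x) h1)
      (integrableOn_cell (f := fun x => (b : ℂ) * cellWave L (n + n) x) h2),
    integral_const_mul, integral_const_mul, integral_cell_cellWave_eq_zero hL hn,
    integral_cell_cellWave_eq_zero hL (add_self_ne_zero hn), integral_cell_const hL]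
  ring

/-- **The occupation of `φ_{-n}` in `g^{⊗N}` is `N · b²L³`** (normalisation `(a²+2b²)L³ = 1`).
[folklore] -/
theorem cellOccupation_neg_cosFun (hL : 0 < L) (hn : n ≠ 0) (hab : (a ^ 2 + 2 * b ^ 2) * L ^ 3 = 1) :
    cellOccupation (m + 1) L (planeWaveMode L (-n)) (cosFun m L n a b) =
      ENNReal.ofReal (((m + 1 : ℕ) : ℝ) * (b ^ 2 * L ^ 3)) := by
  have hL3 : 0 < L ^ 3 := by positivity
  rw [cellOccupation_succ]
  -- the slice integral factorises
  have hslice : ∀ Y : Config m,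
      ∫ x in cell L, conj (planeWaveMode L (-n) x) * cosFun m L n a b (Matrix.vecCons x Y) =
        (((Real.sqrt (L ^ 3))⁻¹ : ℂ) * ((L : ℂ) ^ 3 * b)) *
          prodFun (fun _ : Fin m => cosBody L n a b) Y := by
    intro Y
    have hpt : ∀ x, conj (planeWaveMode L (-n) x) * cosFun m L n a b (Matrix.vecCons x Y) =
        conj (planeWaveMode L (-n) x) * cosBody L n a b x * prodFun (fun _ : Fin m => cosBody L n a b) Y := by
      intro x
      unfold cosFun prodFun
      rw [Fin.prod_univ_succ, Matrix.cons_val_zero]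
      simp only [Matrix.cons_val_succ]
      ring
    simp_rw [hpt]
    rw [integral_mul_const, integral_conj_planeWaveMode_neg_mul_cosBody hL hn]
  simp_rw [hslice]
  have hI : ∫⁻ x in cell L, ((‖cosBody L n a b x‖₊ : ℝ≥0∞) ^ 2) = 1 := by
    rw [lintegral_nnnorm_sq_cosBody hL hn, hab, ENNReal.ofReal_one]
  have hsq : ∀ Y : Config m,
      ((‖(((Real.sqrt (L ^ 3))⁻¹ : ℂ) * ((L : ℂ) ^ 3 * b)) * prodFun (fun _ : Fin m => cosBody L n a b) Y‖₊ :
        ℝ≥0∞) ^ 2) =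
      ENNReal.ofReal (b ^ 2 * L ^ 3) * ((‖prodFun (fun _ : Fin m => cosBody L n a b) Y‖₊ : ℝ≥0∞) ^ 2) := by
    intro Y
    rw [nnnorm_mul, ENNReal.coe_mul, mul_pow]
    congr 1
    rw [coe_nnnorm_sq_eq_ofReal]
    congr 1
    rw [norm_mul, norm_mul, Complex.norm_real, norm_pow, Complex.norm_real, Real.norm_of_nonneg hL.le,
      Real.norm_eq_abs, ← Complex.ofReal_inv, Complex.norm_real, Real.norm_of_nonneg (by positivity)]
    rw [mul_pow, mul_pow, inv_pow, Real.sq_sqrt hL3.le, sq_abs]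
    field_simp
  simp_rw [hsq]
  rw [lintegral_const_mul' _ _ ENNReal.ofReal_ne_top,
    lintegral_nnnorm_sq_prodFun (fun _ => continuous_cosBody L n a b)]
  simp only [hI, Finset.prod_const_one, mul_one]
  rw [ENNReal.ofReal_mul (Nat.cast_nonneg _), ENNReal.ofReal_natCast]
  push_cast
  ring

/-! #### The free energy of `g^{⊗N}` -/

/-- **Kinetic energy of `g^{⊗N}`**: at most `N · 4b²L³ · 4π²|n|²/L²`. [folklore] -/
theorem periodicEnergy_cosState_le (hL : 0 < L) (hn : n ≠ 0) (hab : (a ^ 2 + 2 * b ^ 2) * L ^ 3 = 1) :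
    periodicEnergy 0 (cosState m hL hn a b hab) ≤
      ENNReal.ofReal (((m + 1 : ℕ) : ℝ) * ((4 * (b ^ 2 * L ^ 3)) * (4 * Real.pi ^ 2 * nsq n / L ^ 2))) := by
  unfold periodicEnergy
  simp only [periodicInteraction_zero, zero_mul, add_zero]
  show ∫⁻ X in cellN (m + 1) L, kineticDensity (cosFun m L n a b) X ≤ _
  set C : ℝ≥0∞ := ENNReal.ofReal (4 * (b ^ 2 * (4 * Real.pi ^ 2 * nsq n / L ^ 2))) with hC
  have hF := measurable_nnnorm_sq_cosBody L n a b
  have hpt : ∀ X : Config (m + 1), kineticDensity (cosFun m L n a b) X ≤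
      ∑ i : Fin (m + 1), C * ∏ j ∈ Finset.univ.erase i, ((‖cosBody L n a b (X j)‖₊ : ℝ≥0∞) ^ 2) := by
    intro X
    unfold cosFun
    rw [kineticDensity_prodFun (fun _ => differentiable_cosBody L n a b)]
    refine Finset.sum_le_sum fun i _ => ?_
    rw [mul_comm]
    gcongr
    exact sum_nnnorm_sq_fderiv_cosBody_le hL a b (X i)
  have hmeas : ∀ i : Fin (m + 1), Measurable (fun X : Config (m + 1) =>
      C * ∏ j ∈ Finset.univ.erase i, ((‖cosBody L n a b (X j)‖₊ : ℝ≥0∞) ^ 2)) := fun i =>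
    measurable_const.mul (Finset.measurable_prod _ fun j _ => hF.comp (measurable_pi_apply j))
  have hI : ∫⁻ x in cell L, ((‖cosBody L n a b x‖₊ : ℝ≥0∞) ^ 2) = 1 := by
    rw [lintegral_nnnorm_sq_cosBody hL hn, hab, ENNReal.ofReal_one]
  calc ∫⁻ X in cellN (m + 1) L, kineticDensity (cosFun m L n a b) X
      ≤ ∫⁻ X in cellN (m + 1) L,
          ∑ i : Fin (m + 1), C * ∏ j ∈ Finset.univ.erase i, ((‖cosBody L n a b (X j)‖₊ : ℝ≥0∞) ^ 2) :=
        lintegral_mono hpt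
    _ = ∑ i : Fin (m + 1), ∫⁻ X in cellN (m + 1) L,
          C * ∏ j ∈ Finset.univ.erase i, ((‖cosBody L n a b (X j)‖₊ : ℝ≥0∞) ^ 2) :=
        lintegral_finsetSum _ (fun i _ => hmeas i)
    _ = ∑ _i : Fin (m + 1), ENNReal.ofReal ((4 * (b ^ 2 * L ^ 3)) * (4 * Real.pi ^ 2 * nsq n / L ^ 2)) := by
        refine Finset.sum_congr rfl fun i _ => ?_
        rw [lintegral_const_mul' _ _ ENNReal.ofReal_ne_top, lintegral_prod_erase i hF]
        simp only [hI, Finset.prod_const_one, mul_one]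
        have h4 : 0 ≤ 4 * (b ^ 2 * (4 * Real.pi ^ 2 * nsq n / L ^ 2)) :=
          mul_nonneg (by norm_num) (mul_nonneg (sq_nonneg _)
            (div_nonneg (mul_nonneg (by positivity) (nsq_nonneg n)) (sq_nonneg _)))
        rw [← ENNReal.ofReal_pow hL.le, ← ENNReal.ofReal_mul h4]
        congr 1
        ring
    _ = ENNReal.ofReal (((m + 1 : ℕ) : ℝ) * ((4 * (b ^ 2 * L ^ 3)) * (4 * Real.pi ^ 2 * nsq n / L ^ 2))) := by
        rw [Finset.sum_const, Finset.card_univ, Fintype.card_fin, nsmul_eq_mul,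
          ← ENNReal.ofReal_natCast (m + 1), ← ENNReal.ofReal_mul (Nat.cast_nonneg _)]

end CosState

end Summit.AtomisticToContinuum.BoseEinsteinCondensation.Theorems.FibreConductance.Negative

end
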